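import Summits.QuantumFields.BalabanUV.Beta.CombHId2Words

/-!
# `BalabanUV.Beta.CombHId2Torus` — binder row D1 (OWNER an2), (J-a) dictionary, (C2) at ORDER 2, PART THREE (letters, 1): **THE TORUS READING OF THE
# DERIVATIVE OF THE INVERSE OVER THE PERIODISED TABLES** — `perF M (K2OfK K N S^per Mt^per b′) = −(perF M K · perF M (dM K N S^per Mt^per b′) · perF M K)`

WHY.  PART THREE matches the door's `hId₂` polynomial (leaf-05 `FP/CoarseJetOrderTwoGradedComb`: blocks `Θ, Θᴸ, Ŝ, Γ̂` of `Â := perF M K`, jets `H₁ H₂ Q₁₁ Q₁₂`) with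
`perF M′` of the lattice words of `CombHId2W2Record.dper_tsum_T2comb_succ_read`.  Every `Γ̂ ∕ Θ ∕ Ŝ`-joined bilinear monomial of the polynomial comes from the
word `dM (K2OfK … b′) N S^per Mt^per b` (and the two outer `K X_b K X_{b′} K` words of `K3OfK`): on the torus the derivative of the inverse over the periodised
tables is MINUS the triple product of the fine torus matrices — this file's letter, the order-2 use of gan24-p3's `perF_comp` exactly as C2b's `perF_e3OfK_inl_inl`.
WHAT ([folklore]; 0 `def`, 0 cited fact, 0 `def … : Prop`, 0 sorry; `M = N·M′`, `K` fine-period invariant and decaying, `S ∕ Mt` period covariant and localised —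
C3a's sockets): §1 `dM_dper_translate_inv` (the operator's background derivative over the periodised tables is fine-period invariant — it IS `dper M (dM …)`, C3a
`dper_dM`), `exists_decays_dM_dper` (… and decays — `decays_dper` on C3d-i `exists_biLoc_dM_K2OfK`), `K2OfK_eq_neg_smul_comp`; §2 **`perF_K2OfK_dper`**:
`perF M (K2OfK K N S^per Mt^per ν y′) = −(perF M K * perF M (dM K N S^per Mt^per ν y′) * perF M K)`; §3 `exists_decays_vertexOfM_dper`, **`perF_dM_dper`**
(`perF M (dM …^per b) = perF M (vertexOfK K N S^per b) + perF M (vertexOfM K N Mt^per b)`); §4 `cdper_family_translate`, **`vertexOfM_dper_apply`** (the coarse twin of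
C2a `vertexOfK_dper_apply`: `vertexOfM K N Mt^per μ y x z = Σ_{w∈pbox M′} Σ_ρ perZ M K (N•w) (N•y) (inr ρ) (inr μ) · dper M (Mt ρ w) x z`), **`perF_vertexOfM_dper_apply`**
(the same for the torus matrices — twin of C2b `perF_vertexOfK_dper_apply`), `perZ_coarse_coarse_eq_perF` (the weights are `(perF M K)_{μμ}` entries); §5 **`vertexOfK_apply_of_periodic`**, **`vertexOfM_apply_of_periodic`** (the chain-rule
vertices over an EXACTLY periodic bounded family read on the box — the inner letters for the nested words, whose inner families `S₂^{csf} κ u`, `M₂^{cs} κ u` are copy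
sums: periodic in the inner bond, localised at the outer one); §6 `tsum_csf_translate_inner`, **`dper_tsum_csf_translate_outer`** (`S₂^{per,csf} κ u κ′ u′ :=
dper M (x z ↦ Σ'_n S₂ κ u κ′ (u′+M∘n) x z)` is EXACTLY periodic in BOTH bonds — the copy sum absorbs the inner period, the joint block covariance + C3c `dper_shiftK_per`
the outer one —, i.e. a function of the two TORUS bonds: the shape in which the door's `H₂` binds it).
NOT HERE: `perF` of `vertex2OfK ∕ mixOfK ∕ e4OfKW` (PART THREE letters 2–3), the torus algebra against leaf-05 §1; nothing of Bałaban's asserted; NOT D1,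
NEVER «G-an2-4 closed», NOT BetaPertH, NOT continuum, NOT Clay.

HONEST DEPENDENCY (page 1, mandatory): continuum YM on T⁴ ⇐ BetaPertH ∧ nine spine estimates (0/9 proved); BetaPertH ⇐ (D1) ∧ (D4) ∧ CAP+tail;
G-an2-4 gates asym, D1 and NE2/3/4.  HONEST FRAMING (cell contract, verbatim): «discharging `BetaPertH` makes Bałaban's UV stability UNCONDITIONAL —
a real constructive-QFT result; it is NOT the continuum limit and NOT the Clay problem.»  ABSOLUTE RULE (cell charter, verbatim): «No internally-minted
statement may enter as a cited fact. Every hypothesis is either kernel-proved in this package or a verbatim quotation of a PUBLISHED theorem with page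
reference. The manuscript(s) under audit are NOT citable for their own disputed steps — they are the thing under adjudication; programme-internal
(2001/route/tribunal) claims are never citable.»  Row D1 OWNER an2 (b2b-balaban-beta-an2) gen 44, 2026-08-23; over C3a, C2b, C3d-i and `FP.KernelPeriodisationFib` BY NAME.
-/

noncomputable section

open scoped BigOperators Matrix

namespace Summit.QuantumFields.BalabanUV.Beta.CombHId2Torus

open Literature.MathematicalPhysics.QuantumFieldTheory.Balaban1983to89
open Literature.MathematicalPhysics.QuantumFieldTheory.Balaban1983to89.Beta
open B4TorusKernel.MultiPeriod (translate translate_apply)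
open ExpKernelCalculus (MKer Decays BiLoc VertexFamily comp)
open AffineAveraging (Site)
open OneStepResolventKernel (Fib)
open SecondOrderResponse (dM K2OfK)
open Summit.QuantumFields.BalabanUV.Beta.FP.KernelPeriodisationFib (Idx perF perZ perF_apply perZ_apply perZ_translate_left perZ_translate_right perF_comp perF_smul perF_add summable_translate_of_decays)
open Summit.QuantumFields.BalabanUV.Beta.FP.KernelPeriodisationFibLoc (dper dper_apply dper_translate decays_dper)
open Summit.QuantumFields.BalabanUV.Beta.CombHId1Sandwich (exists_decays_comp)
open Summit.QuantumFields.BalabanUV.Beta.FP.TorusGaugeCovariancePairing (wrapPt wrapPt_coe)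
open Summit.QuantumFields.BalabanUV.Beta.CombHId1Letters (vertexOfK_apply perZ_eq_tsum_translate_left nsmul_translate)
open Summit.QuantumFields.BalabanUV.Beta.FP.KernelPeriodisationFibTrace (tsum_sites_eq_sum_tsum)
open B12Sec2to5 (l1 l1_nonneg)
open B4Sect5Proof (latticeConst latticeConst_nonneg)
open B4Reflection242 (translate_translate)
open B6Lemma24Torus (pbox)
open InterLevelTransport (cwsum cwsum_apply)
open Literature.MathematicalPhysics.QuantumFieldTheory.LatticeForm (quo)
open OneStepResolventKernel (quo_zsmul)
open Summit.QuantumFields.BalabanUV.Beta.CombHId2Letters (dper_dM dper_vertexOfM)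
open OneStepKernelFamily (vertexOfK)
open Summit.QuantumFields.BalabanUV.Beta.CombHId2Words (exists_biLoc_dM_K2OfK)
open Summit.QuantumFields.BalabanUV.Beta.CombHId2CopySum (nsmul_per neg_nsmul_per dper_shiftK_per)
open Summit.QuantumFields.BalabanUV.Beta.FP.KernelPeriodisationFib (translate_eq_add)
open ExpKernelCalculus (shiftK)

variable {d : ℕ} (M : Fin (d + 1) → ℕ) [∀ μ, NeZero (M μ)] {N : ℕ} [NeZero N] {M' : Fin (d + 1) → ℕ} {K : MKer (d + 1) (Fib d)}
  {CK δK CS δS CM δM : ℝ} {S Mt : Fin (d + 1) → Site (d + 1) → MKer (d + 1) (Fib d)}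

/-! ## §1 The operator's background derivative over the periodised tables: invariant and decaying -/

/-- [folklore] `dM K N S^per Mt^per b` is invariant under the fine period lattice (it IS `dper M (dM K N S Mt b)` — C3a `dper_dM` — and `dper` is invariant). -/
theorem dM_dper_translate_inv (hM : ∀ i, M i = N * M' i)
    (hKinv : ∀ (m x z : Site (d + 1)) (a b : Fib d), K (translate M x m) (translate M z m) a b = K x z a b)
    (hK : Decays K CK δK) (hδK : 0 < δK)
    (hSt : ∀ (κ : Fin (d + 1)) (u m x z : Site (d + 1)) (a b : Fib d), S κ (translate M u m) (translate M x m) (translate M z m) a b = S κ u x z a b)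
    (hS : ∀ κ u, BiLoc (S κ u) u u CS δS) (hδS : 0 < δS)
    (hMt : ∀ (ρ : Fin (d + 1)) (w m x z : Site (d + 1)) (a b : Fib d),
      Mt ρ (translate M' w m) (translate M x m) (translate M z m) a b = Mt ρ w x z a b)
    (hMloc : VertexFamily Mt N CM δM) (hδM : 0 < δM) (μ : Fin (d + 1)) (y : Site (d + 1)) (m x z : Site (d + 1)) (a b : Fib d) :
    dM K N (fun κ u => dper M (S κ u)) (fun ρ w => dper M (Mt ρ w)) μ y (translate M x m) (translate M z m) a b
      = dM K N (fun κ u => dper M (S κ u)) (fun ρ w => dper M (Mt ρ w)) μ y x z a b := by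
  rw [← dper_dM M K S Mt hM hKinv hK (hK.nonneg (Sum.inl 0)) hδK hSt hS hδS hMt hMloc hδM μ y, dper_translate]

/-- [folklore] … and decays (`decays_dper` on the bi-localised `dM K N S Mt b` of C3d-i `exists_biLoc_dM_K2OfK`, then C3a `dper_dM`). -/
theorem exists_decays_dM_dper (hM : ∀ i, M i = N * M' i)
    (hKinv : ∀ (m x z : Site (d + 1)) (a b : Fib d), K (translate M x m) (translate M z m) a b = K x z a b)
    (hK : Decays K CK δK) (hδK : 0 < δK)
    (hSt : ∀ (κ : Fin (d + 1)) (u m x z : Site (d + 1)) (a b : Fib d), S κ (translate M u m) (translate M x m) (translate M z m) a b = S κ u x z a b)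
    (hS : ∀ κ u, BiLoc (S κ u) u u CS δS) (hδS : 0 < δS)
    (hMt : ∀ (ρ : Fin (d + 1)) (w m x z : Site (d + 1)) (a b : Fib d),
      Mt ρ (translate M' w m) (translate M x m) (translate M z m) a b = Mt ρ w x z a b)
    (hMloc : VertexFamily Mt N CM δM) (hδM : 0 < δM) (μ : Fin (d + 1)) (y : Site (d + 1)) :
    ∃ C δ : ℝ, 0 < δ ∧ 0 ≤ C ∧ Decays (dM K N (fun κ u => dper M (S κ u)) (fun ρ w => dper M (Mt ρ w)) μ y) C δ := by
  obtain ⟨C₀, δ₀, hδ₀, hdM, -⟩ := exists_biLoc_dM_K2OfK (N := N) hK hδK hS hδS hMloc hδM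
  have hD := decays_dper M (hdM μ y) ((hdM μ y).nonneg (Sum.inl 0)) hδ₀
  rw [dper_dM M K S Mt hM hKinv hK (hK.nonneg (Sum.inl 0)) hδK hSt hS hδS hMt hMloc hδM μ y] at hD
  exact ⟨_, _, half_pos hδ₀, hD.nonneg (Sum.inl 0), hD⟩

omit [∀ μ, NeZero (M μ)] [NeZero N] in
/-- [folklore] `K2OfK K N S Mt b′ = (−1) • (K ∘ dM_{b′} ∘ K)` as kernels (`SecondOrderResponse.K2OfK` unfolded). -/
theorem K2OfK_eq_neg_smul_comp (S' Mt' : Fin (d + 1) → Site (d + 1) → MKer (d + 1) (Fib d)) (ν : Fin (d + 1)) (y' : Site (d + 1)) :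
    K2OfK K N S' Mt' ν y' = (-1 : ℝ) • comp (comp K (dM K N S' Mt' ν y')) K := by
  funext x z a b
  simp only [K2OfK, Pi.smul_apply, smul_eq_mul]
  ring

/-! ## §2 The torus reading of the derivative of the inverse -/

/-- [folklore] **`perF_K2OfK_dper` — ON THE TORUS THE DERIVATIVE OF THE INVERSE OVER THE PERIODISED TABLES IS MINUS THE TRIPLE PRODUCT**:
`perF M (K2OfK K N S^per Mt^per ν y′) = −(perF M K * perF M (dM K N S^per Mt^per ν y′) * perF M K)` (gan24-p3's `perF_comp` ×2 on the invariant decaying factors). -/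
theorem perF_K2OfK_dper (hM : ∀ i, M i = N * M' i)
    (hKinv : ∀ (m x z : Site (d + 1)) (a b : Fib d), K (translate M x m) (translate M z m) a b = K x z a b)
    (hK : Decays K CK δK) (hδK : 0 < δK)
    (hSt : ∀ (κ : Fin (d + 1)) (u m x z : Site (d + 1)) (a b : Fib d), S κ (translate M u m) (translate M x m) (translate M z m) a b = S κ u x z a b)
    (hS : ∀ κ u, BiLoc (S κ u) u u CS δS) (hδS : 0 < δS)
    (hMt : ∀ (ρ : Fin (d + 1)) (w m x z : Site (d + 1)) (a b : Fib d),
      Mt ρ (translate M' w m) (translate M x m) (translate M z m) a b = Mt ρ w x z a b)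
    (hMloc : VertexFamily Mt N CM δM) (hδM : 0 < δM) (ν : Fin (d + 1)) (y' : Site (d + 1)) :
    perF M (K2OfK K N (fun κ u => dper M (S κ u)) (fun ρ w => dper M (Mt ρ w)) ν y')
      = -(perF M K * perF M (dM K N (fun κ u => dper M (S κ u)) (fun ρ w => dper M (Mt ρ w)) ν y') * perF M K) := by
  obtain ⟨CV, δV, hδV, -, hVd⟩ := exists_decays_dM_dper M hM hKinv hK hδK hSt hS hδS hMt hMloc hδM ν y'
  have hVinv := dM_dper_translate_inv M hM hKinv hK hδK hSt hS hδS hMt hMloc hδM ν y'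
  obtain ⟨CX, δX, hδX, hKVd⟩ := exists_decays_comp hK hδK hVd hδV
  rw [K2OfK_eq_neg_smul_comp, perF_smul, ← perF_comp M hK hVd hδK hδV hVinv, ← perF_comp M hKVd hK hδX hδK hKinv, neg_one_smul]

/-! ## §3 The torus matrix of the operator's background derivative is the sum of the two vertex matrices -/

/-- [folklore] the multiplier-column vertex over the periodised coarse-bond table decays (C3a `dper_vertexOfM` + gan24-p3's `decays_dper` on
`SecondOrderResponse.vertexFamily_vertexOfM`). -/
theorem exists_decays_vertexOfM_dper (hM : ∀ i, M i = N * M' i)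
    (hKinv : ∀ (m x z : Site (d + 1)) (a b : Fib d), K (translate M x m) (translate M z m) a b = K x z a b)
    (hK : Decays K CK δK) (hδK : 0 < δK)
    (hMt : ∀ (ρ : Fin (d + 1)) (w m x z : Site (d + 1)) (a b : Fib d),
      Mt ρ (translate M' w m) (translate M x m) (translate M z m) a b = Mt ρ w x z a b)
    (hMloc : VertexFamily Mt N CM δM) (hδM : 0 < δM) (μ : Fin (d + 1)) (y : Site (d + 1)) :
    ∃ C δ : ℝ, 0 < δ ∧ 0 ≤ C ∧ Decays (SecondOrderResponse.vertexOfM K N (fun ρ w => dper M (Mt ρ w)) μ y) C δ := by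
  have hCK : 0 ≤ CK := hK.nonneg (Sum.inl 0)
  have hCM : 0 ≤ CM := (hMloc 0 0).nonneg (Sum.inl 0)
  have hδ₀ : 0 < min δK δM := lt_min hδK hδM
  have h2 := SecondOrderResponse.vertexFamily_vertexOfM (N := N) hK hCK (BalabanStepW2.vertexFamily_mono' hMloc hCM (min_le_right δK δM)) hδ₀
    (min_le_left δK δM) μ y
  have hD := decays_dper M h2 (h2.nonneg (Sum.inl 0)) (half_pos hδ₀)
  rw [dper_vertexOfM M K Mt hM hKinv hK hCK hδK hMt hMloc hδM μ y] at hD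
  exact ⟨_, _, half_pos (half_pos hδ₀), hD.nonneg (Sum.inl 0), hD⟩

/-- [folklore] **`perF_dM_dper`**: `perF M (dM K N S^per Mt^per b) = perF M (vertexOfK K N S^per b) + perF M (vertexOfM K N Mt^per b)` (`perF_add` on the two decaying
vertices — C2b `exists_decays_vertexOfK_dper` and §3's multiplier twin).  The first summand is C2b's column-weighted sum of the periodised tables' torus matrices
(`CombHId1Sandwich.perF_vertexOfK_dper_apply`); the second is its coarse-sublattice twin (PART THREE letters 2). -/
theorem perF_dM_dper (hM : ∀ i, M i = N * M' i)
    (hKinv : ∀ (m x z : Site (d + 1)) (a b : Fib d), K (translate M x m) (translate M z m) a b = K x z a b)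
    (hK : Decays K CK δK) (hδK : 0 < δK)
    (hSt : ∀ (κ : Fin (d + 1)) (u m x z : Site (d + 1)) (a b : Fib d), S κ (translate M u m) (translate M x m) (translate M z m) a b = S κ u x z a b)
    (hS : ∀ κ u, BiLoc (S κ u) u u CS δS) (hδS : 0 < δS)
    (hMt : ∀ (ρ : Fin (d + 1)) (w m x z : Site (d + 1)) (a b : Fib d),
      Mt ρ (translate M' w m) (translate M x m) (translate M z m) a b = Mt ρ w x z a b)
    (hMloc : VertexFamily Mt N CM δM) (hδM : 0 < δM) (μ : Fin (d + 1)) (y : Site (d + 1)) :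
    perF M (dM K N (fun κ u => dper M (S κ u)) (fun ρ w => dper M (Mt ρ w)) μ y)
      = perF M (vertexOfK K N (fun κ u => dper M (S κ u)) μ y) + perF M (SecondOrderResponse.vertexOfM K N (fun ρ w => dper M (Mt ρ w)) μ y) := by
  obtain ⟨C₁, δ₁, hδ₁, -, h₁⟩ := CombHId1Sandwich.exists_decays_vertexOfK_dper M (N := N) hKinv hK hδK hSt hS hδS μ y
  obtain ⟨C₂, δ₂, hδ₂, -, h₂⟩ := exists_decays_vertexOfM_dper M hM hKinv hK hδK hMt hMloc hδM μ y
  exact perF_add M h₁ h₂ hδ₁ hδ₂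

/-! ## §4 The multiplier-column vertex over the periodised coarse-bond table, read on the coarse box -/

omit [∀ μ, NeZero (M μ)] [NeZero N] in
/-- [folklore] the diagonal periodisation of an `M′`-period-covariant coarse-bond family does not see which copy of the bond is named:
`dper M (Mt ρ (w + M′∘m)) = dper M (Mt ρ w)` (the coarse twin of C2a `dper_family_translate`). -/
theorem cdper_family_translate
    (hMt : ∀ (ρ : Fin (d + 1)) (w m x z : Site (d + 1)) (a b : Fib d),
      Mt ρ (translate M' w m) (translate M x m) (translate M z m) a b = Mt ρ w x z a b)
    (ρ : Fin (d + 1)) (w m : Site (d + 1)) : dper M (Mt ρ (translate M' w m)) = dper M (Mt ρ w) := by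
  funext x z a b
  rw [dper_apply, dper_apply, ← (Equiv.addRight m).tsum_eq fun n => Mt ρ (translate M' w m) (translate M x n) (translate M z n) a b]
  refine tsum_congr fun n => ?_
  rw [Equiv.coe_addRight, ← translate_translate M x n m, ← translate_translate M z n m, hMt]

/-- [folklore] **THE MULTIPLIER-COLUMN VERTEX OF THE PERIODISED COARSE-BOND FAMILY, READ ON THE COARSE BOX** (`M = N·M′`):
`vertexOfM K N Mt^per μ y x z a b = Σ_{w ∈ pbox M′} Σ_ρ perZ M K (N•w) (N•y) (inr ρ) (inr μ) · dper M (Mt ρ w) x z a b` — the coarse twin of C2a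
`vertexOfK_dper_apply` (the column sum over the coarse lattice folds onto the coarse box by `cdper_family_translate`; the weights fold into `perZ` by
`nsmul_translate` + `perZ_eq_tsum_translate_left`). -/
theorem vertexOfM_dper_apply [∀ μ, NeZero (M' μ)] (hM : ∀ i, M i = N * M' i)
    (hKinv : ∀ (m x z : Site (d + 1)) (a b : Fib d), K (translate M x m) (translate M z m) a b = K x z a b)
    (hK : Decays K CK δK) (hδK : 0 < δK)
    (hMt : ∀ (ρ : Fin (d + 1)) (w m x z : Site (d + 1)) (a b : Fib d),
      Mt ρ (translate M' w m) (translate M x m) (translate M z m) a b = Mt ρ w x z a b)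
    (hMloc : VertexFamily Mt N CM δM) (hδM : 0 < δM) (μ : Fin (d + 1)) (y x z : Site (d + 1)) (a b : Fib d) :
    SecondOrderResponse.vertexOfM K N (fun ρ w => dper M (Mt ρ w)) μ y x z a b
      = ∑ w : ↥(pbox M'), ∑ ρ : Fin (d + 1),
          perZ M K ((N : ℤ) • (w : Site (d + 1))) ((N : ℤ) • y) (Sum.inr ρ) (Sum.inr μ) * dper M (Mt ρ (w : Site (d + 1))) x z a b := by
  have hCK : 0 ≤ CK := hK.nonneg (Sum.inl 0)
  have hCM : 0 ≤ CM := (hMloc 0 0).nonneg (Sum.inl 0)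
  -- a uniform bound on the periodised coarse-bond tables
  have hbd : ∀ (ρ : Fin (d + 1)) (w : Site (d + 1)), |dper M (Mt ρ w) x z a b| ≤ CM * latticeConst (d + 1) (δM / 2) := by
    intro ρ w
    have hD := decays_dper M (hMloc ρ w) hCM hδM x z a b
    rw [sub_self, show l1 (0 : Site (d + 1)) = 0 by simp [l1], mul_zero, Real.exp_zero, mul_one] at hD
    refine hD.trans ?_
    have h1 : Real.exp (-(δM / 2) * l1 (x - z)) ≤ 1 := by
      rw [Real.exp_le_one_iff]; exact mul_nonpos_of_nonpos_of_nonneg (by linarith) (l1_nonneg _)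
    calc CM * latticeConst (d + 1) (δM / 2) * Real.exp (-(δM / 2) * l1 (x - z))
        ≤ CM * latticeConst (d + 1) (δM / 2) * 1 := by
          exact mul_le_mul_of_nonneg_left h1 (mul_nonneg hCM (latticeConst_nonneg (d + 1) (half_pos hδM).le))
      _ = CM * latticeConst (d + 1) (δM / 2) := mul_one _
  unfold SecondOrderResponse.vertexOfM
  rw [Finset.sum_comm]
  refine Finset.sum_congr rfl fun ρ _ => ?_
  rw [cwsum_apply]
  have hinj : Function.Injective (fun w : Site (d + 1) => (N : ℤ) • w) := fun w w' h => by
    simpa only [quo_zsmul] using congrArg (quo N) h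
  have hG : Summable fun w : Site (d + 1) => SecondOrderResponse.colM K N μ y ρ w * dper M (Mt ρ w) x z a b := by
    refine (((ExpKernelCalculus.summable_exp_shift' hδK ((N : ℤ) • y)).comp_injective hinj).mul_left
      (CK * (CM * latticeConst (d + 1) (δM / 2)))).of_norm_bounded fun w => ?_
    rw [Real.norm_eq_abs, abs_mul, Function.comp_apply,
      show CK * (CM * latticeConst (d + 1) (δM / 2)) * Real.exp (-δK * l1 ((N : ℤ) • w - (N : ℤ) • y))
        = (CK * Real.exp (-δK * l1 ((N : ℤ) • w - (N : ℤ) • y))) * (CM * latticeConst (d + 1) (δM / 2)) by ring]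
    exact mul_le_mul (hK _ _ _ _) (hbd ρ w) (abs_nonneg _) (mul_nonneg hCK (Real.exp_pos _).le)
  rw [tsum_sites_eq_sum_tsum M' hG]
  refine Finset.sum_congr rfl fun w _ => ?_
  simp only [cdper_family_translate M hMt, SecondOrderResponse.colM]
  rw [tsum_mul_right, perZ_eq_tsum_translate_left M hKinv]
  congr 1
  refine tsum_congr fun n => ?_
  rw [nsmul_translate hM]

/-- [folklore] **THE TORUS MATRIX OF THE MULTIPLIER-COLUMN VERTEX AS A FINITE SUM OF THE PERIODISED COARSE-BOND TABLES' TORUS MATRICES**: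
`perF M (vertexOfM K N Mt^per μ y) P Q = Σ_{w ∈ pbox M′} Σ_ρ perZ M K (N•w) (N•y) (inr ρ) (inr μ) · perF M (dper M (Mt ρ w)) P Q` — the coarse twin of C2b
`perF_vertexOfK_dper_apply` (§4 under the period sum; term-wise summability from gan24-p3's `decays_dper`). -/
theorem perF_vertexOfM_dper_apply [∀ μ, NeZero (M' μ)] (hM : ∀ i, M i = N * M' i)
    (hKinv : ∀ (m x z : Site (d + 1)) (a b : Fib d), K (translate M x m) (translate M z m) a b = K x z a b)
    (hK : Decays K CK δK) (hδK : 0 < δK)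
    (hMt : ∀ (ρ : Fin (d + 1)) (w m x z : Site (d + 1)) (a b : Fib d),
      Mt ρ (translate M' w m) (translate M x m) (translate M z m) a b = Mt ρ w x z a b)
    (hMloc : VertexFamily Mt N CM δM) (hδM : 0 < δM) (μ : Fin (d + 1)) (y : Site (d + 1)) (P Q : Idx M (Fib d)) :
    perF M (SecondOrderResponse.vertexOfM K N (fun ρ w => dper M (Mt ρ w)) μ y) P Q
      = ∑ w : ↥(pbox M'), ∑ ρ : Fin (d + 1),
          perZ M K ((N : ℤ) • (w : Site (d + 1))) ((N : ℤ) • y) (Sum.inr ρ) (Sum.inr μ) * perF M (dper M (Mt ρ (w : Site (d + 1)))) P Q := by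
  have hCM : 0 ≤ CM := (hMloc 0 0).nonneg (Sum.inl 0)
  have hM1 : ∀ i, 1 ≤ M i := fun i => Nat.one_le_iff_ne_zero.mpr (NeZero.ne (M i))
  have hsum : ∀ (w : Site (d + 1)) (ρ : Fin (d + 1)), Summable fun n : Site (d + 1) => dper M (Mt ρ w) P.1 (translate M Q.1 n) P.2 Q.2 := fun w ρ => by
    have hD := decays_dper M (hMloc ρ w) hCM hδM
    exact summable_translate_of_decays hD (hD.nonneg (Sum.inl 0)) (half_pos hδM) hM1 _ _ _ _
  rw [perF_apply, perZ_apply]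
  simp only [vertexOfM_dper_apply M hM hKinv hK hδK hMt hMloc hδM]
  have h1 : ∀ w ∈ (Finset.univ : Finset ↥(pbox M')), Summable fun n : Site (d + 1) => ∑ ρ : Fin (d + 1),
      perZ M K ((N : ℤ) • (w : Site (d + 1))) ((N : ℤ) • y) (Sum.inr ρ) (Sum.inr μ) * dper M (Mt ρ (w : Site (d + 1))) P.1 (translate M Q.1 n) P.2 Q.2 :=
    fun w _ => summable_sum fun ρ _ => (hsum (w : Site (d + 1)) ρ).mul_left _
  rw [Summable.tsum_finsetSum h1]
  refine Finset.sum_congr rfl fun w _ => ?_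
  have h2 : ∀ ρ ∈ (Finset.univ : Finset (Fin (d + 1))), Summable fun n : Site (d + 1) =>
      perZ M K ((N : ℤ) • (w : Site (d + 1))) ((N : ℤ) • y) (Sum.inr ρ) (Sum.inr μ) * dper M (Mt ρ (w : Site (d + 1))) P.1 (translate M Q.1 n) P.2 Q.2 :=
    fun ρ _ => (hsum (w : Site (d + 1)) ρ).mul_left _
  rw [Summable.tsum_finsetSum h2]
  refine Finset.sum_congr rfl fun ρ _ => ?_
  rw [tsum_mul_left, perF_apply, perZ_apply M (dper M (Mt ρ (w : Site (d + 1))))]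

omit [NeZero N] in
/-- [folklore] **THE TORUS READING OF THE COARSE WEIGHTS**: `perZ M K (N•w) (N•y) (inr ρ) (inr μ) = (perF M K) ((wrapPt M (N•w), inr ρ), (wrapPt M (N•y), inr μ))` — the
multiplier–multiplier entry of the fine torus matrix of `K` at the two coarse points (the twin of C2a `perZ_coarse_col_eq_perF`). -/
theorem perZ_coarse_coarse_eq_perF
    (hKinv : ∀ (m x z : Site (d + 1)) (a b : Fib d), K (translate M x m) (translate M z m) a b = K x z a b)
    (w y : Site (d + 1)) (ρ μ : Fin (d + 1)) :
    perZ M K ((N : ℤ) • w) ((N : ℤ) • y) (Sum.inr ρ) (Sum.inr μ)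
      = perF M K (wrapPt M ((N : ℤ) • w), Sum.inr ρ) (wrapPt M ((N : ℤ) • y), Sum.inr μ) := by
  rw [perF_apply, wrapPt_coe, wrapPt_coe]
  conv_lhs => rw [← GAN24.KernelPeriodisation.translate_wrap_quo M ((N : ℤ) • w), ← GAN24.KernelPeriodisation.translate_wrap_quo M ((N : ℤ) • y)]
  rw [perZ_translate_left M hKinv, perZ_translate_right]

/-! ## §5 The chain-rule vertex over an EXACTLY PERIODIC bounded family, read on the box (the inner letter for the nested words) -/

omit [NeZero N] in
/-- [folklore] **THE CHAIN-RULE VERTEX OVER AN EXACTLY `M`-PERIODIC BOUNDED FAMILY, READ ON THE BOX**: for `T κ (u + M∘m) = T κ u` and `|T κ u x z a b| ≤ B`,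
`vertexOfK K N T ν y′ x z a b = Σ_{u ∈ pbox M} Σ_κ perZ M K u (N•y′) (inl κ) (inr ν) · T κ u x z a b` — NO localisation of `T` at its bond is asked (the inner
families of the nested words, `S₂^{csf} κ u` and `M₂^{cs} κ u`, are copy sums: exactly periodic in the inner bond, localised at the OUTER one). -/
theorem vertexOfK_apply_of_periodic
    (hKinv : ∀ (m x z : Site (d + 1)) (a b : Fib d), K (translate M x m) (translate M z m) a b = K x z a b)
    (hK : Decays K CK δK) (hδK : 0 < δK)
    {T : Fin (d + 1) → Site (d + 1) → MKer (d + 1) (Fib d)} (hTper : ∀ (κ : Fin (d + 1)) (u m : Site (d + 1)), T κ (translate M u m) = T κ u)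
    {B : ℝ} (hTB : ∀ (κ : Fin (d + 1)) (u x z : Site (d + 1)) (a b : Fib d), |T κ u x z a b| ≤ B)
    (ν : Fin (d + 1)) (y' x z : Site (d + 1)) (a b : Fib d) :
    vertexOfK K N T ν y' x z a b
      = ∑ u : ↥(pbox M), ∑ κ : Fin (d + 1), perZ M K (u : Site (d + 1)) ((N : ℤ) • y') (Sum.inl κ) (Sum.inr ν) * T κ (u : Site (d + 1)) x z a b := by
  rw [vertexOfK_apply, Finset.sum_comm]
  refine Finset.sum_congr rfl fun κ _ => ?_
  have hB : 0 ≤ B := (abs_nonneg _).trans (hTB 0 0 0 0 (Sum.inl 0) (Sum.inl 0))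
  have hG : Summable fun u : Site (d + 1) => K u ((N : ℤ) • y') (Sum.inl κ) (Sum.inr ν) * T κ u x z a b := by
    refine ((ExpKernelCalculus.summable_exp_shift' hδK ((N : ℤ) • y')).mul_left (CK * B)).of_norm_bounded fun u => ?_
    rw [Real.norm_eq_abs, abs_mul, show CK * B * Real.exp (-δK * l1 (u - (N : ℤ) • y'))
      = (CK * Real.exp (-δK * l1 (u - (N : ℤ) • y'))) * B by ring]
    exact mul_le_mul (hK u _ _ _) (hTB κ u x z a b) (abs_nonneg _) (mul_nonneg (hK.nonneg (Sum.inl κ)) (Real.exp_pos _).le)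
  rw [tsum_sites_eq_sum_tsum M hG]
  refine Finset.sum_congr rfl fun u _ => ?_
  simp only [hTper]
  rw [tsum_mul_right, perZ_eq_tsum_translate_left M hKinv]

omit [∀ μ, NeZero (M μ)] in
/-- [folklore] **THE MULTIPLIER-COLUMN VERTEX OVER AN EXACTLY `M′`-PERIODIC BOUNDED COARSE-BOND FAMILY, READ ON THE COARSE BOX** (`M = N·M′`): for
`T ρ (w + M′∘m) = T ρ w` and `|T ρ w x z a b| ≤ B`, `vertexOfM K N T ν y′ x z a b = Σ_{w ∈ pbox M′} Σ_ρ perZ M K (N•w) (N•y′) (inr ρ) (inr ν) · T ρ w x z a b`. -/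
theorem vertexOfM_apply_of_periodic [∀ μ, NeZero (M' μ)] (hM : ∀ i, M i = N * M' i)
    (hKinv : ∀ (m x z : Site (d + 1)) (a b : Fib d), K (translate M x m) (translate M z m) a b = K x z a b)
    (hK : Decays K CK δK) (hδK : 0 < δK)
    {T : Fin (d + 1) → Site (d + 1) → MKer (d + 1) (Fib d)} (hTper : ∀ (ρ : Fin (d + 1)) (w m : Site (d + 1)), T ρ (translate M' w m) = T ρ w)
    {B : ℝ} (hTB : ∀ (ρ : Fin (d + 1)) (w x z : Site (d + 1)) (a b : Fib d), |T ρ w x z a b| ≤ B)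
    (ν : Fin (d + 1)) (y' x z : Site (d + 1)) (a b : Fib d) :
    SecondOrderResponse.vertexOfM K N T ν y' x z a b
      = ∑ w : ↥(pbox M'), ∑ ρ : Fin (d + 1), perZ M K ((N : ℤ) • (w : Site (d + 1))) ((N : ℤ) • y') (Sum.inr ρ) (Sum.inr ν) * T ρ (w : Site (d + 1)) x z a b := by
  have hCK : 0 ≤ CK := hK.nonneg (Sum.inl 0)
  have hB : 0 ≤ B := (abs_nonneg _).trans (hTB 0 0 0 0 (Sum.inl 0) (Sum.inl 0))
  unfold SecondOrderResponse.vertexOfM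
  rw [Finset.sum_comm]
  refine Finset.sum_congr rfl fun ρ _ => ?_
  rw [cwsum_apply]
  have hinj : Function.Injective (fun w : Site (d + 1) => (N : ℤ) • w) := fun w w' h => by
    simpa only [quo_zsmul] using congrArg (quo N) h
  have hG : Summable fun w : Site (d + 1) => SecondOrderResponse.colM K N ν y' ρ w * T ρ w x z a b := by
    refine (((ExpKernelCalculus.summable_exp_shift' hδK ((N : ℤ) • y')).comp_injective hinj).mul_left (CK * B)).of_norm_bounded fun w => ?_
    rw [Real.norm_eq_abs, abs_mul, Function.comp_apply,
      show CK * B * Real.exp (-δK * l1 ((N : ℤ) • w - (N : ℤ) • y')) = (CK * Real.exp (-δK * l1 ((N : ℤ) • w - (N : ℤ) • y'))) * B by ring]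
    exact mul_le_mul (hK _ _ _ _) (hTB ρ w x z a b) (abs_nonneg _) (mul_nonneg hCK (Real.exp_pos _).le)
  rw [tsum_sites_eq_sum_tsum M' hG]
  refine Finset.sum_congr rfl fun w _ => ?_
  simp only [hTper, SecondOrderResponse.colM]
  rw [tsum_mul_right, perZ_eq_tsum_translate_left M hKinv]
  congr 1
  refine tsum_congr fun n => ?_
  rw [nsmul_translate hM]

/-! ## §6 The copy-summed, periodised second-order slot is EXACTLY periodic in both bonds -/

omit [∀ μ, NeZero (M μ)] [NeZero N] in
/-- [folklore] the second-bond copy sum `u′ ↦ Σ'_n S₂ κ u κ′ (u′ + M∘n)` is EXACTLY `M`-periodic in `u′` (re-indexing `n ↦ m + n`; no covariance used). -/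
theorem tsum_csf_translate_inner (S₂ : Fin (d + 1) → Site (d + 1) → Fin (d + 1) → Site (d + 1) → MKer (d + 1) (Fib d))
    (κ : Fin (d + 1)) (u : Site (d + 1)) (κ' : Fin (d + 1)) (u' m : Site (d + 1)) :
    (fun x z a c => ∑' n : Site (d + 1), S₂ κ u κ' (translate M (translate M u' m) n) x z a c)
      = fun x z a c => ∑' n : Site (d + 1), S₂ κ u κ' (translate M u' n) x z a c := by
  funext x z a c
  simp only [translate_translate]
  exact (Equiv.addLeft m).tsum_eq fun n => S₂ κ u κ' (translate M u' n) x z a c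

omit [∀ μ, NeZero (M μ)] [NeZero N] in
/-- [folklore] **… AND, ONCE PERIODISED, EXACTLY PERIODIC IN ITS OUTER BOND TOO** (`M = N·M′`, joint block covariance `hS₂s` of the record): moving the outer bond by a
fine period `M∘m = N•(M′∘m)` shifts every copy by the same vector (the copy index re-indexed `n ↦ n + m`), and `dper` forgets a period shift (C3c `dper_shiftK_per`):
`dper M (x z ↦ Σ'_n S₂ κ (u + M∘m) κ′ (u′ + M∘n) x z) = dper M (x z ↦ Σ'_n S₂ κ u κ′ (u′ + M∘n) x z)`.  So `S₂^{per,csf}` is a function of the two TORUS bonds. -/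
theorem dper_tsum_csf_translate_outer (hM : ∀ i, M i = N * M' i)
    {S₂ : Fin (d + 1) → Site (d + 1) → Fin (d + 1) → Site (d + 1) → MKer (d + 1) (Fib d)}
    (hS₂s : ∀ (κ : Fin (d + 1)) (u : Site (d + 1)) (κ' : Fin (d + 1)) (u' t : Site (d + 1)),
      S₂ κ (u + (N : ℤ) • t) κ' (u' + (N : ℤ) • t) = shiftK (-((N : ℤ) • t)) (S₂ κ u κ' u'))
    (κ : Fin (d + 1)) (u : Site (d + 1)) (κ' : Fin (d + 1)) (u' m : Site (d + 1)) :
    dper M (fun x z a c => ∑' n : Site (d + 1), S₂ κ (translate M u m) κ' (translate M u' n) x z a c)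
      = dper M (fun x z a c => ∑' n : Site (d + 1), S₂ κ u κ' (translate M u' n) x z a c) := by
  have key : (fun x z a c => ∑' n : Site (d + 1), S₂ κ (translate M u m) κ' (translate M u' n) x z a c)
      = shiftK (fun i => (M i : ℤ) * (-m) i) (fun x z a c => ∑' n : Site (d + 1), S₂ κ u κ' (translate M u' n) x z a c) := by
    funext x z a c
    rw [← (Equiv.addRight m).tsum_eq fun n => S₂ κ (translate M u m) κ' (translate M u' n) x z a c]
    have e1 : translate M u m = u + (N : ℤ) • fun i => (M' i : ℤ) * m i := by
      rw [nsmul_per M hM, translate_eq_add]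
    have e2 : ∀ n : Site (d + 1), translate M u' (n + m) = translate M u' n + (N : ℤ) • fun i => (M' i : ℤ) * m i := by
      intro n; rw [nsmul_per M hM, ← translate_translate, translate_eq_add]
    simp only [Equiv.coe_addRight, e1, e2, hS₂s, ← neg_nsmul_per M hM m]
    rfl
  rw [key, dper_shiftK_per]

end Summit.QuantumFields.BalabanUV.Beta.CombHId2Torus

end
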